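import Summits.ValiantsHypothesis.ValiantsHypothesis.Theorems.KPlusLogSqLawTropicalBExchangeStage
import Summits.ValiantsHypothesis.ValiantsHypothesis.Theorems.KPlusLogSqLawTropicalBDisplacement

/-!
# Route «KPlusLogSqLaw», crux `TropicalB` (stmt-ValiantsHypothesis-19771) — the EXCHANGE SECTOR, part 2:
# the LINEAR LAW `n ≤ m·(K−1)` under the exchange axiom; class-uniform designs inhabit the sector

HONEST FRAMING.  Helper toward the registered stubs `stub_tropThin` / `stub_tropFat` of `Cruxes/TropicalB/Lines/birth.lean` (crux
`Summit.ValiantsHypothesis.ValiantsHypothesis.Theses.KPlusLogSqLaw.TropicalB`, item stmt-ValiantsHypothesis-19771, route KPlusLogSqLaw,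
DRAFT; cell `pub-symmetroid`, seat val-sym-trop-p1 g9, 2026-08-27; `--supports … --as helper`).  Continuation of
`…TropicalBExchangeStage` (see its header for the reading and the stage argument).  A SECTOR theorem: nothing here bounds `TropicalB` for
general designs, and nothing bears on `WeakLifting`, DoorA26 / DoorA34, `MatrixDescartes` (stmt-ValiantsHypothesis-18050) or VP ≠ VNP.

* `rankSum_eq`, `rankSum_lt_of_upper_le` — layer cake: the rank sum `Σ_b λ_b` is the sum of the upper class counts; dominance of all upper
  counts plus distinct slopes forces it to increase STRICTLY;
* `chain_le_of_exchange` / `alternating_chain_le_of_exchange` — **THE LAW**: for a design with sorted exponents whose present terms satisfy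
  the term-level exchange axiom (M-concavity of the coloured-matching value function), every chain of unique optima at strictly increasing
  integer slopes with distinct consecutive terms (resp. with alternating signs — the hypothesis list of `TropicalCensus.TropRootLawAt`) has
  `n ≤ m·(K−1)`: the arithmetic-progression row of the census (`…TropicalBSumset.chain_le_of_ap`), `TropicalB`'s inequality with `C = 2`
  there, for ALL exponent vectors and supports;
* `exchange_of_classUniform`, `classUniform_chain_le_of_exchange` — the sector is inhabited: class-uniform full-support designs
  (`v a b l = w a b + t l`, the frozen-permutation sector of `…TropicalBClassUniform`) satisfy the axiom with equality (re-class one column on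
  each side), and the law re-derives `classUniform_chain_le` for sorted exponents.

READING (docstring only, nothing asserted).  The crux's excess over the linear row is carried by the steps at which the class profile
does NOT move up in the dominance order («carries»: SHIFT-THREE's phase changes, the staircase's digit resets); under (M-EXC) there are none.
Located, not formalised: the separable (single-permutation) designs are in the sector too, by the M-concavity of transportation optima
(Murota 2003, Ch. 9).  On the real side of Conjecture B the matching statement is degenerate in the same direction: a pencil with positive
semidefinite coefficients has a stable — hence Lorentzian — determinant `det(Σ_l z_l S_l)` (Borcea–Brändén), Lorentzian polynomials
tropicalise to M-convex functions (Brändén–Huh, arXiv:1902.03719), and such a pencil has no positive zeros at all.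
[kernel argument: this file; references as in part 1]
-/

set_option linter.dupNamespace false
set_option autoImplicit false

namespace Summit.ValiantsHypothesis.ValiantsHypothesis.Theorems.KPlusLogSqLaw.ExchangeSector

open Summit.ValiantsHypothesis.ValiantsHypothesis.Theorems.MatrixDescartes.Negative
open Summit.ValiantsHypothesis.ValiantsHypothesis.Theorems.LacunarySymmetroidMatrixDescartes
open Summit.ValiantsHypothesis.ValiantsHypothesis.Theorems.LacunarySymmetroidMatrixDescartes.TropicalCensus
open scoped BigOperators
open Finset

variable {m K : ℕ}

/-! ## 4. The rank-sum potential and the linear chain bound -/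

/-- layer-cake: the sum of the class indices of a term is the sum of its upper class counts. [folklore] -/
theorem rankSum_eq (f : Fin m → Fin K) :
    ∑ b, ((f b : ℕ)) = ∑ c ∈ range K, (univ.filter fun b => c + 1 ≤ (f b : ℕ)).card := by
  simp only [card_filter]
  rw [sum_comm]
  refine sum_congr rfl fun b _ => ?_
  rw [← card_filter]
  have : (range K).filter (fun c => c + 1 ≤ (f b : ℕ)) = range (f b : ℕ) := by
    ext c
    simp only [mem_filter, mem_range]
    have := (f b).isLt
    omega
  rw [this, card_range]

/-- class counts from upper counts. [folklore] -/
theorem card_class_eq_upper_sub (f : Fin m → Fin K) (l : Fin K) :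
    (univ.filter fun b => f b = l).card =
      (univ.filter fun b => (l : ℕ) ≤ (f b : ℕ)).card - (univ.filter fun b => (l : ℕ) + 1 ≤ (f b : ℕ)).card := by
  have h : (univ.filter fun b => (l : ℕ) ≤ (f b : ℕ)) =
      (univ.filter fun b => f b = l) ∪ (univ.filter fun b => (l : ℕ) + 1 ≤ (f b : ℕ)) := by
    ext b
    simp only [mem_filter, mem_univ, true_and, mem_union, Fin.ext_iff]
    omega
  have hdis : Disjoint (univ.filter fun b => f b = l) (univ.filter fun b => (l : ℕ) + 1 ≤ (f b : ℕ)) := by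
    rw [disjoint_filter]
    intro b _ hb
    rw [hb]; omega
  rw [h, card_union_of_disjoint hdis]
  omega

/-- **STRICT RANK-SUM STEP.**  If the class profile of `q` dominates that of `p` (all upper counts) and the slopes differ, then
the rank sum `Σ_b λ_b` strictly increases from `p` to `q`. [this file] -/
theorem rankSum_lt_of_upper_le (d : Fin K → ℕ) {p q : Equiv.Perm (Fin m) × (Fin m → Fin K)}
    (hdom : ∀ c : ℕ, (univ.filter fun b => c ≤ (p.2 b : ℕ)).card ≤ (univ.filter fun b => c ≤ (q.2 b : ℕ)).card)
    (hsl : TropicalCensus.slope d p ≠ TropicalCensus.slope d q) :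
    ∑ b, ((p.2 b : ℕ)) < ∑ b, ((q.2 b : ℕ)) := by
  by_contra hcon
  push Not at hcon
  rw [rankSum_eq p.2, rankSum_eq q.2] at hcon
  -- termwise `≤` and total `≥` force termwise equality on `range K`
  have heq : ∀ c ∈ range K, (univ.filter fun b => c + 1 ≤ (p.2 b : ℕ)).card =
      (univ.filter fun b => c + 1 ≤ (q.2 b : ℕ)).card := by
    have hle : ∀ c ∈ range K, (univ.filter fun b => c + 1 ≤ (p.2 b : ℕ)).card ≤
        (univ.filter fun b => c + 1 ≤ (q.2 b : ℕ)).card := fun c _ => hdom (c + 1)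
    exact (sum_eq_sum_iff_of_le hle).mp (le_antisymm (sum_le_sum hle) hcon)
  -- hence all upper counts agree
  have hall : ∀ c : ℕ, (univ.filter fun b => c ≤ (p.2 b : ℕ)).card = (univ.filter fun b => c ≤ (q.2 b : ℕ)).card := by
    intro c
    rcases Nat.eq_zero_or_pos c with rfl | hc
    · simp
    · by_cases hcK : c ≤ K
      · have := heq (c - 1) (mem_range.mpr (by omega))
        rwa [Nat.sub_add_cancel hc] at this
      · have e : ∀ f : Fin m → Fin K, (univ.filter fun b => c ≤ (f b : ℕ)) = ∅ := by
          intro f; ext b; simp only [mem_filter, mem_univ, true_and, notMem_empty, iff_false]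
          have := (f b).isLt; omega
        rw [e, e]
  -- hence all class counts agree, hence the slopes agree
  have hcnt : ∀ l : Fin K, (univ.filter fun b => p.2 b = l).card = (univ.filter fun b => q.2 b = l).card := by
    intro l; rw [card_class_eq_upper_sub, card_class_eq_upper_sub, hall, hall]
  apply hsl
  unfold TropicalCensus.slope
  rw [sum_class_eq (fun l => (d l : ℤ)) p.2, sum_class_eq (fun l => (d l : ℤ)) q.2]
  exact sum_congr rfl fun l _ => by rw [hcnt l]

/-- the rank sum is at most `m·(K−1)`. [folklore] -/
theorem rankSum_le (f : Fin m → Fin K) : ∑ b, ((f b : ℕ)) ≤ m * (K - 1) := by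
  calc ∑ b, ((f b : ℕ)) ≤ ∑ _b : Fin m, (K - 1) := sum_le_sum fun b _ => by have := (f b).isLt; omega
    _ = m * (K - 1) := by rw [sum_const, card_univ, Fintype.card_fin, smul_eq_mul]

/-- **THE EXCHANGE SECTOR IS LINEAR.**  Let `(d, v, ε)` be a design of format `(m, K)` with monotone exponents whose present
terms satisfy the TERM-LEVEL EXCHANGE AXIOM `hex` (= Murota's (M-EXC) for the coloured-matching value function
`g(n⃗) = max {−V(p) : p present with class profile n⃗}`).  Then every chain of unique optima at strictly increasing integer slopes
with distinct consecutive terms has at most `m·(K−1)` steps — the arithmetic-progression row of the census, inside `TropicalB`'s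
budget with `C = 2`, at EVERY format and for ALL exponent vectors (no scale separation, no support hypothesis).
Proof: the rank sum `Σ_b λ_b ∈ [0, m(K−1)]` strictly increases along the chain (`upper_le_of_dominant` +
`rankSum_lt_of_upper_le` + `slope_lt_of_dominant`). [this file] -/
theorem chain_le_of_exchange (d : Fin K → ℕ) (hd : Monotone d) (v ε : Fin m → Fin m → Fin K → ℤ)
    (hex : ∀ p q : Equiv.Perm (Fin m) × (Fin m → Fin K), termSign ε p ≠ 0 → termSign ε q ≠ 0 →
      ∀ i : Fin K, (univ.filter fun b => q.2 b = i).card < (univ.filter fun b => p.2 b = i).card →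
        ∃ j : Fin K, (univ.filter fun b => p.2 b = j).card < (univ.filter fun b => q.2 b = j).card ∧
          ∃ p' q' : Equiv.Perm (Fin m) × (Fin m → Fin K), termSign ε p' ≠ 0 ∧ termSign ε q' ≠ 0 ∧
            (∀ l, (univ.filter fun b => p'.2 b = l).card + (if l = i then 1 else 0) =
              (univ.filter fun b => p.2 b = l).card + (if l = j then 1 else 0)) ∧
            (∀ l, (univ.filter fun b => q'.2 b = l).card + (if l = j then 1 else 0) =
              (univ.filter fun b => q.2 b = l).card + (if l = i then 1 else 0)) ∧
            (∑ b, v (p'.1 b) b (p'.2 b)) + (∑ b, v (q'.1 b) b (q'.2 b)) ≤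
              (∑ b, v (p.1 b) b (p.2 b)) + (∑ b, v (q.1 b) b (q.2 b)))
    {n : ℕ} (θ : Fin (n + 1) → ℤ) (p : Fin (n + 1) → Equiv.Perm (Fin m) × (Fin m → Fin K))
    (hθ : StrictMono θ) (hdom : ∀ k, IsDominant d v ε (θ k) (p k))
    (hne : ∀ k : Fin n, p k.castSucc ≠ p k.succ) : n ≤ m * (K - 1) := by
  -- the rank sum strictly increases at every step
  have hstep : ∀ k : Fin n, ∑ b, (((p k.castSucc).2 b : ℕ)) < ∑ b, (((p k.succ).2 b : ℕ)) := by
    intro k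
    have hlt : θ k.castSucc < θ k.succ := hθ Fin.castSucc_lt_succ
    refine rankSum_lt_of_upper_le d (upper_le_of_dominant d hd v ε hex hlt (hdom _) (hdom _)) ?_
    exact ne_of_lt (slope_lt_of_dominant d v ε hlt (hne k) (hdom _) (hdom _))
  -- hence it gains at least one per step
  have hgain : ∀ k : Fin (n + 1), (∑ b, (((p 0).2 b : ℕ))) + (k : ℕ) ≤ ∑ b, (((p k).2 b : ℕ)) := by
    intro k
    induction k using Fin.induction with
    | zero => simp
    | succ k ih =>
      have := hstep k
      have e : ((k.succ : ℕ)) = (k.castSucc : ℕ) + 1 := by simp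
      rw [e]; omega
  have hlast := hgain (Fin.last n)
  simp only [Fin.val_last] at hlast
  have := rankSum_le (p (Fin.last n)).2
  omega

/-- **Sign-alternating form** (the hypothesis list of `TropicalCensus.TropRootLawAt`): under the exchange axiom every
sign-alternating dominant chain of the design has at most `m·(K−1)` sign changes. [this file] -/
theorem alternating_chain_le_of_exchange (d : Fin K → ℕ) (hd : Monotone d) (v ε : Fin m → Fin m → Fin K → ℤ)
    (hex : ∀ p q : Equiv.Perm (Fin m) × (Fin m → Fin K), termSign ε p ≠ 0 → termSign ε q ≠ 0 →
      ∀ i : Fin K, (univ.filter fun b => q.2 b = i).card < (univ.filter fun b => p.2 b = i).card →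
        ∃ j : Fin K, (univ.filter fun b => p.2 b = j).card < (univ.filter fun b => q.2 b = j).card ∧
          ∃ p' q' : Equiv.Perm (Fin m) × (Fin m → Fin K), termSign ε p' ≠ 0 ∧ termSign ε q' ≠ 0 ∧
            (∀ l, (univ.filter fun b => p'.2 b = l).card + (if l = i then 1 else 0) =
              (univ.filter fun b => p.2 b = l).card + (if l = j then 1 else 0)) ∧
            (∀ l, (univ.filter fun b => q'.2 b = l).card + (if l = j then 1 else 0) =
              (univ.filter fun b => q.2 b = l).card + (if l = i then 1 else 0)) ∧
            (∑ b, v (p'.1 b) b (p'.2 b)) + (∑ b, v (q'.1 b) b (q'.2 b)) ≤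
              (∑ b, v (p.1 b) b (p.2 b)) + (∑ b, v (q.1 b) b (q.2 b)))
    {n : ℕ} (θ : Fin (n + 1) → ℤ) (p : Fin (n + 1) → Equiv.Perm (Fin m) × (Fin m → Fin K))
    (hθ : StrictMono θ) (hdom : ∀ k, IsDominant d v ε (θ k) (p k))
    (halt : ∀ k : Fin n, termSign ε (p k.castSucc) * termSign ε (p k.succ) < 0) : n ≤ m * (K - 1) := by
  refine chain_le_of_exchange d hd v ε hex θ p hθ hdom fun k h => ?_
  have := halt k
  rw [h] at this
  exact absurd this (not_lt.mpr (mul_self_nonneg _))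



open Classical in
/-- **CARRY LAW (unconditional; every design, every exponent vector).**  Call a step `k → k+1` of a dominant chain a CARRY if the class
profile does NOT move up in the dominance order (some upper class count `#{b : λ_b ≥ c}` drops).  Then
`n ≤ m(K−1) + (m(K−1)+1)·#carries`: between carries the rank sum `Σ_b λ_b ∈ [0, m(K−1)]` strictly increases (`rankSum_lt_of_upper_le`),
and the tree's telescoping count `card_ups_le` (…TropicalBDisplacement) charges each drop at most `m(K−1)`.  Under the exchange axiom there
are no carries (`upper_le_of_dominant`), which is `chain_le_of_exchange` again; for general designs the crux's excess over the linear row is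
carried by the carries (SHIFT-THREE: `m − 1` of them for `≈ m²/2` steps).  Profile-level twin of `steps_le_pred_mul_add_displacement` (columns
moved) and of the lex reading of `…TropicalBLexStrict` (super-increasing exponents), valid for every `d`.  (`open Classical`: the
carry predicate quantifies over all thresholds.) [this file] -/
theorem chain_le_of_carries (d : Fin K → ℕ) (v ε : Fin m → Fin m → Fin K → ℤ)
    {n : ℕ} (θ : Fin (n + 1) → ℤ) (p : Fin (n + 1) → Equiv.Perm (Fin m) × (Fin m → Fin K))
    (hθ : StrictMono θ) (hdom : ∀ k, IsDominant d v ε (θ k) (p k))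
    (hne : ∀ k : Fin n, p k.castSucc ≠ p k.succ) :
    n ≤ m * (K - 1) + (m * (K - 1) + 1) *
      (univ.filter fun k : Fin n => ¬ ∀ c : ℕ, (univ.filter fun b => c ≤ ((p k.castSucc).2 b : ℕ)).card ≤
        (univ.filter fun b => c ≤ ((p k.succ).2 b : ℕ)).card).card := by
  classical
  set Φ : Fin (n + 1) → ℕ := fun k => ∑ b, (((p k).2 b : ℕ)) with hΦ
  set M := m * (K - 1) with hM
  have hups := card_ups_le Φ M (fun k => rankSum_le (p k).2)
  -- dominance steps are rises of the rank sum
  have hgood : (univ.filter fun k : Fin n => ∀ c : ℕ, (univ.filter fun b => c ≤ ((p k.castSucc).2 b : ℕ)).card ≤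
      (univ.filter fun b => c ≤ ((p k.succ).2 b : ℕ)).card).card ≤ (univ.filter fun k : Fin n => Φ k.castSucc < Φ k.succ).card := by
    refine card_le_card fun k hk => ?_
    rw [mem_filter] at hk ⊢
    refine ⟨mem_univ _, rankSum_lt_of_upper_le d hk.2 ?_⟩
    exact ne_of_lt (slope_lt_of_dominant d v ε (hθ Fin.castSucc_lt_succ) (hne k) (hdom _) (hdom _))
  -- drops of the rank sum are carries
  have hdrop : (univ.filter fun k : Fin n => Φ k.succ < Φ k.castSucc).card ≤
      (univ.filter fun k : Fin n => ¬ ∀ c : ℕ, (univ.filter fun b => c ≤ ((p k.castSucc).2 b : ℕ)).card ≤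
        (univ.filter fun b => c ≤ ((p k.succ).2 b : ℕ)).card).card := by
    refine card_le_card fun k hk => ?_
    rw [mem_filter] at hk ⊢
    refine ⟨mem_univ _, fun hall => ?_⟩
    have := rankSum_lt_of_upper_le d hall
      (ne_of_lt (slope_lt_of_dominant d v ε (hθ Fin.castSucc_lt_succ) (hne k) (hdom _) (hdom _)))
    exact absurd hk.2 (not_lt.mpr this.le)
  have hn := card_filter_add_card_filter_not (s := (univ : Finset (Fin n)))
    (fun k : Fin n => ∀ c : ℕ, (univ.filter fun b => c ≤ ((p k.castSucc).2 b : ℕ)).card ≤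
      (univ.filter fun b => c ≤ ((p k.succ).2 b : ℕ)).card)
  rw [card_univ, Fintype.card_fin] at hn
  have hmul : M * ((univ.filter fun k : Fin n => Φ k.succ < Φ k.castSucc).card + 1) ≤
      M * ((univ.filter fun k : Fin n => ¬ ∀ c : ℕ, (univ.filter fun b => c ≤ ((p k.castSucc).2 b : ℕ)).card ≤
        (univ.filter fun b => c ≤ ((p k.succ).2 b : ℕ)).card).card + 1) := Nat.mul_le_mul_left _ (by omega)
  nlinarith [hups, hgood, hdrop, hn, hmul]

/-! ## 5. The sector is inhabited: CLASS-UNIFORM designs satisfy the exchange axiom (with equality) -/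

/-- class counts add up to `m`. [folklore] -/
theorem sum_card_class (f : Fin m → Fin K) : ∑ l, (univ.filter fun b => f b = l).card = m := by
  rw [← card_eq_sum_card_fiberwise (s := (univ : Finset (Fin m))) (t := (univ : Finset (Fin K))) (f := f)
    (fun b _ => mem_univ _), card_univ, Fintype.card_fin]

/-- class counts after re-classing one column. [folklore] -/
theorem card_class_update (μ : Fin m → Fin K) (b₀ : Fin m) (j l : Fin K) :
    (univ.filter fun b => Function.update μ b₀ j b = l).card + (if l = μ b₀ then 1 else 0) =
      (univ.filter fun b => μ b = l).card + (if l = j then 1 else 0) := by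
  classical
  rw [card_filter, card_filter]
  have h1 := sum_erase_add univ (fun b => if Function.update μ b₀ j b = l then 1 else 0) (mem_univ b₀)
  have h2 := sum_erase_add univ (fun b => if μ b = l then 1 else 0) (mem_univ b₀)
  have h3 : ∑ b ∈ univ.erase b₀, (if Function.update μ b₀ j b = l then 1 else 0) =
      ∑ b ∈ univ.erase b₀, (if μ b = l then 1 else 0) :=
    sum_congr rfl fun b hb => by rw [Function.update_of_ne (ne_of_mem_erase hb)]
  simp only [Function.update_self] at h1
  rw [← h1, ← h2, h3]
  have hX : (if j = l then 1 else 0 : ℕ) = (if l = j then 1 else 0 : ℕ) := by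
    by_cases h : j = l
    · rw [if_pos h, if_pos h.symm]
    · rw [if_neg h, if_neg (fun h' => h h'.symm)]
  have hY : (if μ b₀ = l then 1 else 0 : ℕ) = (if l = μ b₀ then 1 else 0 : ℕ) := by
    by_cases h : μ b₀ = l
    · rw [if_pos h, if_pos h.symm]
    · rw [if_neg h, if_neg (fun h' => h h'.symm)]
  rw [hX, ← hY]
  ring

/-- **CLASS-UNIFORM DESIGNS ARE IN THE EXCHANGE SECTOR.**  If the class enters every valuation only through a class constant,
`v a b l = w a b + t l`, and the support is full, then the term-level exchange axiom holds (with equality in the value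
inequality): re-class one column of class `i` of `p` to `j` and one column of class `j` of `q` to `i`.  Hence
`chain_le_of_exchange` recovers the tree's `classUniform_chain_le` (`…TropicalBClassUniform`, `n ≤ m·(K−1)`) for monotone
exponents, as the simplest inhabitant of the sector. [folklore] -/
theorem exchange_of_classUniform (v ε : Fin m → Fin m → Fin K → ℤ) (w : Fin m → Fin m → ℤ) (t : Fin K → ℤ)
    (hv : ∀ a b l, v a b l = w a b + t l) (hε : ∀ a b l, ε a b l ≠ 0) :
    ∀ p q : Equiv.Perm (Fin m) × (Fin m → Fin K), termSign ε p ≠ 0 → termSign ε q ≠ 0 →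
      ∀ i : Fin K, (univ.filter fun b => q.2 b = i).card < (univ.filter fun b => p.2 b = i).card →
        ∃ j : Fin K, (univ.filter fun b => p.2 b = j).card < (univ.filter fun b => q.2 b = j).card ∧
          ∃ p' q' : Equiv.Perm (Fin m) × (Fin m → Fin K), termSign ε p' ≠ 0 ∧ termSign ε q' ≠ 0 ∧
            (∀ l, (univ.filter fun b => p'.2 b = l).card + (if l = i then 1 else 0) =
              (univ.filter fun b => p.2 b = l).card + (if l = j then 1 else 0)) ∧
            (∀ l, (univ.filter fun b => q'.2 b = l).card + (if l = j then 1 else 0) =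
              (univ.filter fun b => q.2 b = l).card + (if l = i then 1 else 0)) ∧
            (∑ b, v (p'.1 b) b (p'.2 b)) + (∑ b, v (q'.1 b) b (q'.2 b)) ≤
              (∑ b, v (p.1 b) b (p.2 b)) + (∑ b, v (q.1 b) b (q.2 b)) := by
  classical
  -- every term is present under full support
  have hpres : ∀ r : Equiv.Perm (Fin m) × (Fin m → Fin K), termSign ε r ≠ 0 := by
    intro r
    unfold termSign
    exact mul_ne_zero (Units.ne_zero _) (prod_ne_zero_iff.mpr fun b _ => hε _ _ _)
  intro p q _ _ i hi
  -- a class `j` where `q` has more columns than `p`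
  have hj : ∃ j : Fin K, (univ.filter fun b => p.2 b = j).card < (univ.filter fun b => q.2 b = j).card := by
    by_contra hcon
    push Not at hcon
    have h1 := sum_card_class p.2
    have h2 := sum_card_class q.2
    have hlt : ∑ l, (univ.filter fun b => q.2 b = l).card < ∑ l, (univ.filter fun b => p.2 b = l).card :=
      sum_lt_sum (fun l _ => hcon l) ⟨i, mem_univ _, hi⟩
    omega
  obtain ⟨j, hj⟩ := hj
  refine ⟨j, hj, ?_⟩
  -- a column of class `i` in `p` and a column of class `j` in `q`
  obtain ⟨b₀, hb₀⟩ : ∃ b₀, p.2 b₀ = i := by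
    have : 0 < (univ.filter fun b => p.2 b = i).card := by omega
    obtain ⟨b₀, hb₀⟩ := card_pos.mp this
    exact ⟨b₀, (mem_filter.mp hb₀).2⟩
  obtain ⟨b₁, hb₁⟩ : ∃ b₁, q.2 b₁ = j := by
    have : 0 < (univ.filter fun b => q.2 b = j).card := by omega
    obtain ⟨b₁, hb₁⟩ := card_pos.mp this
    exact ⟨b₁, (mem_filter.mp hb₁).2⟩
  refine ⟨(p.1, Function.update p.2 b₀ j), (q.1, Function.update q.2 b₁ i), hpres _, hpres _, ?_, ?_, ?_⟩
  · intro l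
    have := card_class_update p.2 b₀ j l
    rw [hb₀] at this
    exact this
  · intro l
    have := card_class_update q.2 b₁ i l
    rw [hb₁] at this
    exact this
  · have e1 := sum_update_arg (fun b l => v (p.1 b) b l) p.2 b₀ j
    have e2 := sum_update_arg (fun b l => v (q.1 b) b l) q.2 b₁ i
    rw [e1, e2, hb₀, hb₁, hv (p.1 b₀) b₀ i, hv (p.1 b₀) b₀ j, hv (q.1 b₁) b₁ j, hv (q.1 b₁) b₁ i]
    linarith

/-- **Corollary (the class-uniform row, re-derived through the sector).**  For a class-uniform design with full support and
monotone exponents every dominant chain with distinct consecutive terms has `n ≤ m·(K−1)` — the tree's `classUniform_chain_le`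
as the simplest instance of `chain_le_of_exchange`. [folklore] -/
theorem classUniform_chain_le_of_exchange (d : Fin K → ℕ) (hd : Monotone d) (v ε : Fin m → Fin m → Fin K → ℤ)
    (w : Fin m → Fin m → ℤ) (t : Fin K → ℤ) (hv : ∀ a b l, v a b l = w a b + t l) (hε : ∀ a b l, ε a b l ≠ 0)
    {n : ℕ} (θ : Fin (n + 1) → ℤ) (p : Fin (n + 1) → Equiv.Perm (Fin m) × (Fin m → Fin K))
    (hθ : StrictMono θ) (hdom : ∀ k, IsDominant d v ε (θ k) (p k))
    (hne : ∀ k : Fin n, p k.castSucc ≠ p k.succ) : n ≤ m * (K - 1) :=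
  chain_le_of_exchange d hd v ε (exchange_of_classUniform v ε w t hv hε) θ p hθ hdom hne

end Summit.ValiantsHypothesis.ValiantsHypothesis.Theorems.KPlusLogSqLaw.ExchangeSector
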